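/-
Copyright: statement-level skeleton of a published paper (lit-balaban cell, Phase-2 proof seat p25, gen 22). No proof
claims beyond what the kernel checks below.
-/
import Literature.MathematicalPhysics.QuantumFieldTheory.BalabanImbrieJaffe1984to88.BIJ88WalkIneq312Split245Decay
import Literature.MathematicalPhysics.QuantumFieldTheory.BalabanImbrieJaffe1984to88.BIJ88WalkSplit245GeometryZd
import Literature.MathematicalPhysics.QuantumFieldTheory.BalabanImbrieJaffe1984to88.BIJ88WalkSiteSummabilityZd
import Literature.MathematicalPhysics.QuantumFieldTheory.BalabanImbrieJaffe1984to88.BIJ88WalkIneq312NonVacuity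

/-!
# `BalabanImbrieJaffe1984to88.BIJ88WalkIneq312Split245Zd` — T. Bałaban, J. Imbrie, A. Jaffe, *Effective action and
cluster properties of the abelian Higgs model*, Commun. Math. Phys. **114** (1988) 257–315 [BalabanImbrieJaffe1988],
§5.14 p. 312 [PDF 56], verbatim: *"These considerations lead to the following estimate: |G_k(X)| ≤
c(F(X))(e^β(L^kε/ε₀)^{1/4−α})^{β′|X∖∪_cX_c|} × Π_{X_{σ_1} ⊂ X : dist(X_{σ_1}, Λ₁₂^{(k)c}) < r(e_k)} [c(L^kε)^{−m(c)}e^{−m′(c)}]."*,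
p. 310 [PDF 54]: *"We give random walk expansions for the propagators … The leading terms, with only propagators
C^{(k)}_{Λ₁₂^{(k)},loc}, …, we transform further. The others, localized in region X, have a factor of e^{−cr(e_k)|X|}."*
and Sect. 2 p. 264 [PDF 8]: *"a random walk expansion as in [6] can be used to prove that |C^{(k)}_Λ(u; x₁, x₂)| ≦
ce^{−c|x₁−x₂|}. (2.41) … C^{(k)}_Λ(u) = C^{(k)}_{Λ,loc}(u) + Σ_X C^{(k)}_{Λ,X}(u), (2.45) … |C^{(k)}_{Λ,X}(u; x₁, x₂)| ≦
e^{−cr(e_k)|X|}. (2.46)"* ([6] = [Balaban1983RegularityDecay], (2.13): walks on the lattice of `M`-cubes, *"|j − j′| =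
max_μ|j_μ − j′_μ|"*) — **THE HEAD THEOREM OF ROW C2.Claim@312 ON PRINT'S SPLIT (2.45), ON `ℤ^d`** (p25 gen 22; file
W6e, a MEMBER of the row, owner r16, referee ref-5; the head of record and every earlier file UNCHANGED).

W6b′ (`BIJ88WalkIneq312Split245Decay.ineq312_remainder_bdry_split245_decay_walks`) is the head on print's split in the
ABSTRACT setting of [6] (label distance `d`, touching relation, blocks, site metric, lattice-geometry letters `hblk`,
`hnear`, `D`, `s_c`, `Δ`, `C_s` as hypotheses).  Here every one of these is DISCHARGED in p36's `ℤ^d` dictionary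
(`BIJ88WalkGeometryZd`: labels `pos : J ↪ ℤ^d` with [6]'s adjacency `cubeAdj`, `r(e_k)`-cubes = cube indices of side `ℓ`
labels, sites per label unit `M′`, blocks `ldistZ ≤ M′t`) extended to the SITES of the model of record by an injective
position map `posS : sites ↪ ℤ^d` and a site-to-cube map `cube` consistent with it (`(cube x) = cubeIdx (ℓM′)(posS x)`):
`hblk` by `BIJ88WalkSplit245GeometryZd.touch_cube_of_ldistZ_le` (`t < ℓ`), `hnear` by `cubeIdx_touch_of_supDist_lt`
(`2ρ < ℓM′`, print's `½r(e_k)` vs the cube side), `D = Δ = 3^d` by `card_touch_univ_le`, `s_c = (ℓM′)^d` by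
`card_filter_cubeIdx_eq_le`, `C_s = (2/(1 − e^{−δ/(M′d)}))^d` by `BIJ88WalkSiteSummabilityZd.sum_exp_neg_supDist_le`, and
[6]'s geometry exactly as in p36's `ineq246_Zd` (`K = D_w = 3^d`, `s = ℓ`, `μ = M′`, `b₀ = M′t`, `s₀ = (2t+1)^d`).
RESULT `ineq312_remainder_bdry_split245_Zd`: the typed leaf `Ineq312` for the located remainder activities of the §5.13
model with print's product cutoffs, on print's split over the connected unions of cubes, with HYPOTHESES only: [6]'s
ANALYTIC walk hypotheses (`|C_ω| ≤ Aβ^{|ω|}` with end-point locality on `cubeAdj`-walks, `3^dβ ≤ e^{−δ}`, *"r(e_k) large"*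
`(2t+1)^dA/(1 − 3^dβ) ≤ e^{δℓ/(32·9^d)}`, `r(e_k) ≤ M_wℓ`), the dictionary data (`pos`, `posS`, `cube`, `cadj` = touching
off the diagonal, `t < ℓ`, `ℓ/8 ≤ (ρ − M′t)/M′`, `2ρ < ℓM′`), the direction sizes, the NUMBERS (`4 ≤ c·r(e_k)` etc. with
`c = δ/(32·9^d·M_w)`, `K₀ = ((2t+1)^dA/(1 − 3^dβ))e^{2δt}`), and the head's clauses C2/C4/C5, `K_V`, (5.2.3).

statement-level skeleton of published theorems with citation tags; proofs where landed; nothing here is a claim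
about the Yang–Mills mass gap

PDF held: `paper:balaban1988-cmp114-bij-abelian-higgs-effective-action` (journal page = PDF page + 256); p. 312 =
PDF 56, p. 310 = PDF 54, p. 264 = PDF 8.

CITATION HEADER (lean-in-tree rule).  lit-balaban cell (HOME `run/shared/lean/pub/lit-balaban/`), Phase 2, seat p25
gen 22; row **C2.Claim@312** of `HOME/lit-balaban-r16/ROWS-C2-part2.md` (owner r16, referee ref-5; MEMBER); reader
edges to rows C2.Eq2.41–2.46 (owner r18).  USED BY NAME, nothing restated:
`BIJ88WalkIneq312Split245Decay.ineq312_remainder_bdry_split245_decay_walks` (W6b′), `BIJ88WalkSplit245GeometryZd.*`,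
`BIJ88WalkSiteSummabilityZd.sum_exp_neg_supDist_le`, `BIJ88WalkGeometryZd.*` (p36), `Balaban1983to89.B4RandomWalk213.{cubeAdj,
card_cubeAdj_le}`, the §5.13 model of record.

## What is proved (0 `sorry`, standard axioms, no new `Prop` facts; one theorem + one kernel `example`, no definitions)

* §1 **`ineq312_remainder_bdry_split245_Zd`**; §2 a kernel non-vacuity `example` of it on `ℤ^1`.
DISCHARGED ON `ℤ^d` (no longer hypotheses; owner's v2.365 row text «lattice constants»): `s_c = (ℓM′)^d` sites per cube,
near-degree `D = 3^d`, cube-adjacency degree `Δ = 3^d` (`Rk` = symmetrized `cadj` ⊆ touching, `nbr` = the touching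
cubes), `C_s = (2/(1 − e^{−c₁/d}))^d` with `c₁ = δ/M′` (the (2.41) rate per site), `hblk`, `htri`, `hnear`, and [6]'s
geometric letters (`K = K_c = D_w = 3^d`, `s = ℓ`, `μ = M′`, `b₀ = M′t`, `s₀ = (2t+1)^d`).  The typed rows are NOT
hypotheses here either: (2.46) `Ineq246` and the (2.41) two-constant decay letter (`K₀`, `c₁`) are CONSUMED BY NAME
through W6b′ (`BIJ88Ineq246Walks.ineq246`, p36; `BIJ88Decay241Walks.abs_cLoc_le_exp`, p02), i.e. derived from [6]'s walk
hypotheses below.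
HYPOTHESES THAT REMAIN (complete list, by binder): (R1) [6]'s ANALYTIC walk hypotheses on the kernels `Cw` of the
(2.42)-walk pieces — `hmaj` `|C_ω(x₁,x₂)| ≤ Aβ^{|ω|}` (`hA`, `hβ0`), `hnz` (a non-zero `C_ω(x₁,x₂)` has `ω` nearest-neighbour
for `cubeAdj pos` and `x₁`, `x₂` in the blocks of its ends), `hDβ` `3^dβ ≤ e^{−δ}` (`hδ`), `hlarge` *"r(e_k) large"*
`(2t+1)^dA/(1 − 3^dβ) ≤ e^{δℓ/(32·9^d)}`, `hs` `r(e_k) ≤ M_wℓ` (`hMw`); (R2) the DICTIONARY DATA — injective position maps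
`pos : J → ℤ^d` (`hpos`), `posS : sites → ℤ^d` (`hposS`), the site-to-cube map `cube` with `hcube`
`(cube x) = cubeIdx (ℓM′) (posS x)`, the off-diagonal touching relation `cadj` (`hcadj`, `htouch`), and the three
inequalities `htℓ` `t < ℓ`, `hρ8` `ℓ/8 ≤ (ρ − M′t)/M′`, `h2ρ` `2ρ < ℓM′`; (R3) the DIRECTION SIZES `R_∞`, `R₁` (`hobs`,
`hlegs`: one-cube test vectors with `‖w‖_∞ ≤ R_∞`, `Σ|w| ≤ R₁`) and `‖ℱ|_W‖_∞` inside `K_w = R_∞ + ‖ℱ|_W‖_∞ + 1`; legs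
one-cube with `≤ L` per cube (`hleg`, `hL`); (R4) the NUMBERS, with `c = δ/(32·9^d·M_w)` (`hc`) and
`K₀ = ((2t+1)^dA/(1 − 3^dβ))e^{2δt}` (`hK₀`), `C_s` as above (`hCs`): `h4` `4 ≤ c·r(e_k)`, `hθrek` `e^{−c r(e_k)/4} ≤ θ`,
`hsmall` `(3^d+1)²e·e^{−c r(e_k)/2} ≤ ½`, `hBl'` `K₀C_sR₁K_w ≤ B_ℓ`, `hθw'` `e^{−c r(e_k)/4}(ℓM′)^dR₁K_w ≤ θ_w`
(`θ, θ_v, θ_w ∈ (0,1]`, `1 ≤ B_ℓ`); (R5) the HEAD'S OWN CLAUSES verbatim — `hvert` (C2), `hbeat` (C4), `bdry` (C5),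
`hV` (`K_V`), `hg`/`hgc` ((5.2.3) profile), the moment letters `hobsm`/`hlegsm`, `hPD`, `hcV`/`hcV0`, `hy`.
HONEST SCOPE: (a) as W6b/W6b′ ((H5) pre-cluster-expansion; the head's clauses C2/C4/C5 verbatim); (b) [6]'s ANALYTIC
hypotheses remain (the majorant with end-point locality = [6] Lemma 2.1 for the actual `C^{(k)}_Λ(u)` of (2.40), not
constructed); (c) the dictionary is DATA: which `ℤ^d` points the model's sites and labels are is not derived from the
§5.13 model (its sites are abstract), and `cube`/`hcube` ask that every `r(e_k)`-cube holding a site holds a label (true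
on the torus of print).  NOT summit progress; NOT continuum; NOT Clay.  Imports `BIJ88WalkIneq312Split245Decay`,
`BIJ88WalkSplit245GeometryZd`, `BIJ88WalkSiteSummabilityZd`; modifies nothing.
-/

noncomputable section

namespace Literature.MathematicalPhysics.QuantumFieldTheory.BalabanImbrieJaffe1984to88.BIJ88WalkIneq312Split245Zd

open Classical MeasureTheory Matrix Finset
open scoped BigOperators ContDiff
open Literature.MathematicalPhysics.QuantumFieldTheory.Balaban1983to89
open B4RandomWalk213 (cubeAdj card_cubeAdj_le)
open B2Eq228Conditioning (weight source)
open BIJ88PolymerRep5134 (corner)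
open BIJ88PolymerRep5134Gauss (prec src)
open BIJ88VertexIbp311 (vexp)
open BIJ88RandomWalk242 BIJ88WalkGeometryZd BIJ88WalkSplit245GeometryZd
open BIJ88WalkSiteSummabilityZd (sum_exp_neg_supDist_le)
open BIJ88WalkIneq312Split245Decay (ineq312_remainder_bdry_split245_decay_walks)
open BIJ88WalkRun311 BIJ88WalkExpansion311 BIJ88WalkExpansionGeo311 BIJ88WalkTermCount312
  BIJ88WalkRemainderActivity312 BIJ88WalkIneq312Remainder
open Literature.Probability.LatticeModels (IsRConnected)

variable {ι : Type} [Fintype ι] {κ : Type} [LinearOrder κ] {dd : ℕ}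
variable {α I : Type} [Fintype α] [DecidableEq α] [Fintype I] [DecidableEq I]
  {blk : α → I} {Δ : Matrix α α ℝ} {ℱ : α → ℝ} {W : Finset I} {J : Type} [Fintype J] [DecidableEq J]

/-- **THE HEAD THEOREM OF ROW C2.Claim@312 ON PRINT'S SPLIT (2.45), ON `ℤ^d`**: W6b′'s
`ineq312_remainder_bdry_split245_decay_walks` with its lattice-geometry letters DISCHARGED in p36's `ℤ^d` dictionary
extended to the model's sites (`posS`, `cube`; see the header): `hblk`, `hnear`, `D = Δ = 3^d`, `s_c = (ℓM′)^d`,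
`C_s = (2/(1 − e^{−δ/(M′d)}))^d`, and [6]'s geometry as in `BIJ88Ineq247Walks.ineq246_Zd`.  What remains: [6]'s analytic
walk hypotheses, the dictionary data and its three inequalities (`t < ℓ`, `ℓ/8 ≤ (ρ − M′t)/M′`, `2ρ < ℓM′`), the
direction sizes, the numbers, the head's clauses.
[cite: BalabanImbrieJaffe1988, §5.14 p.312 (estimate preceding (5.14.5)); p.310; (2.41), (2.43)-(2.46) p.264; (5.2.1)-(5.2.4) p.278] -/
theorem ineq312_remainder_bdry_split245_Zd (hPD : (prec blk Δ W (corner ℝ W)).PosDef) (hd : 0 < dd)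
    -- the `ℤ^d` dictionary: labels `pos`, sites `posS` (unit lattice, `M′` sites per label unit), cubes of `ℓ` labels
    (pos : J → Fin dd → ℤ) (hpos : Function.Injective pos)
    (posS : {x : α // blk x ∈ W} → Fin dd → ℤ) (hposS : Function.Injective posS)
    {ℓ M' t : ℕ} (hℓ : 0 < ℓ) (hM' : 0 < M') (htℓ : t < ℓ) (ρr : ℝ) (hρ8 : (ℓ : ℝ) / 8 ≤ (ρr - (M' : ℝ) * t) / M')
    (h2ρ : 2 * ρr < ((ℓ * M' : ℕ) : ℝ))
    (cadj : Cube pos ℓ → Cube pos ℓ → Prop) [DecidableRel cadj]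
    (hcadj : ∀ c c', cadj c c' → cubeAdj Subtype.val c c') (htouch : ∀ c c', cubeAdj Subtype.val c c' → c = c' ∨ cadj c c')
    (cube : {x : α // blk x ∈ W} → Cube pos ℓ) (hcube : ∀ x, (cube x).1 = cubeIdx (ℓ * M') (posS x))
    (Cw : Walk J → {x : α // blk x ∈ W} → {x : α // blk x ∈ W} → ℝ)
    -- [6]'s analytic hypotheses (p36's ℤ^d form)
    {A βw δ : ℝ} (hA : 0 ≤ A) (hβ0 : 0 ≤ βw) (hδ : 0 < δ)
    (hDβ : ((3 ^ dd : ℕ) : ℝ) * βw ≤ Real.exp (-δ))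
    (hmaj : ∀ γ x₁ x₂, |Cw γ x₁ x₂| ≤ A * βw ^ γ.len)
    (hnz : ∀ γ x₁ x₂, Cw γ x₁ x₂ ≠ 0 → γ.IsNN (cubeAdj pos) ∧
      ldistZ M' pos γ.start (posS x₁) ≤ (M' : ℝ) * t ∧ ldistZ M' pos γ.last (posS x₂) ≤ (M' : ℝ) * t)
    {Mw rek : ℝ} (hMw : 0 < Mw) (hs : rek ≤ Mw * ℓ)
    (hlarge : ((2 * t + 1) ^ dd : ℕ) * A / (1 - ((3 ^ dd : ℕ) : ℝ) * βw) ≤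
      Real.exp (δ * ℓ / (32 * ((3 ^ dd : ℕ) : ℝ) * ((3 ^ dd : ℕ) : ℝ))))
    {c : ℝ} (hc : c = δ / (32 * ((3 ^ dd : ℕ) : ℝ) * ((3 ^ dd : ℕ) : ℝ) * Mw))
    {K₀ : ℝ} (hK₀ : K₀ = ((2 * t + 1) ^ dd : ℕ) * A / (1 - ((3 ^ dd : ℕ) : ℝ) * βw) * Real.exp (2 * δ * ((M' : ℝ) * t) / M'))
    {Cs : ℝ} (hCs : Cs = (2 / (1 - Real.exp (-(δ / M' / dd)))) ^ dd)
    (hsmall : (((3 ^ dd : ℕ) : ℝ) + 1) ^ 2 * (Real.exp 1 * Real.exp (-(c * rek / 2))) ≤ 1 / 2)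
    {Rinf R1 : ℝ} (hRinf : 0 ≤ Rinf) (hR1 : 0 ≤ R1)
    {cv : ι → ℝ} {legs : ι → List ({x : α // blk x ∈ W} → ℝ)} {obs : κ → List ({x : α // blk x ∈ W} → ℝ)} {M : ℕ}
    {oc : κ → Finset (Cube pos ℓ)} {vc : ι → Finset (Cube pos ℓ)} {cV : ι → ℝ} {Bl θ θv θw : ℝ}
    {legCube : ι → ℕ → Cube pos ℓ} {L : ℕ}
    {B : Type} (Bs : Finset B) {y : B → {x : α // blk x ∈ W}} (hy : Set.InjOn y Bs)
    {g : ℝ → ℝ} (hg : ContDiff ℝ ∞ g) {cg : ℝ}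
    (hgc : ∀ (n : ℕ) (x : ℝ), |iteratedDeriv n g x| ≤ cg ^ n * (n : ℝ) ^ (cg * n))
    {KV p μs vs : ℝ} (hV : ∀ φ, |vexp cv legs φ| ≤ KV) (hp1 : 1 ≤ p) (hμs : 0 ≤ μs) (hvs : 0 ≤ vs)
    (hobsm : ∀ j, ∀ w ∈ obs j, |w ⬝ᵥ ((prec blk Δ W (corner ℝ W))⁻¹ *ᵥ src blk ℱ W)| ≤ μs ∧
      w ⬝ᵥ ((prec blk Δ W (corner ℝ W))⁻¹ *ᵥ w) ≤ vs)
    (hlegsm : ∀ m, ∀ w ∈ legs m, |w ⬝ᵥ ((prec blk Δ W (corner ℝ W))⁻¹ *ᵥ src blk ℱ W)| ≤ μs ∧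
      w ⬝ᵥ ((prec blk Δ W (corner ℝ W))⁻¹ *ᵥ w) ≤ vs)
    (hθ0 : 0 < θ) (hθ1 : θ ≤ 1) (hBl : 1 ≤ Bl) (hcV0 : ∀ m, 0 ≤ cV m)
    (hθv : 0 < θv) (hθv1 : θv ≤ 1) (hθw : 0 < θw) (hθw1 : θw ≤ 1) (hcV : ∀ m, |cv m| ≤ cV m)
    (hobs : ∀ j, ∀ w ∈ obs j, (∃ k, ∀ z, w z ≠ 0 → cube z = k) ∧ ‖w‖ ≤ Rinf ∧ ∑ x, |w x| ≤ R1)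
    (hlegs : ∀ m, ∀ w ∈ legs m, (∃ k, ∀ z, w z ≠ 0 → cube z = k) ∧ ‖w‖ ≤ Rinf ∧ ∑ x, |w x| ≤ R1)
    (hvert : ∀ m, cV m * Bl ^ (legs m).length ≤ θv * θ ^ (vc m).card)
    (hleg : ∀ m j x, ((legs m).getD j 0) x ≠ 0 → cube x = legCube m j)
    (hL : ∀ k, (∑ m, ((range (legs m).length).filter fun j => legCube m j = k).card) ≤ L)
    (h4 : 4 ≤ c * rek) (hθrek : Real.exp (-(c * rek / 4)) ≤ θ)
    (hBl' : K₀ * Cs * (R1 * (Rinf + ‖src blk ℱ W‖ + 1)) ≤ Bl)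
    (hθw' : Real.exp (-(c * rek / 4)) * (((ℓ * M') ^ dd : ℕ) : ℝ) * (R1 * (Rinf + ‖src blk ℱ W‖ + 1)) ≤ θw)
    (bdry : Finset κ)
    (hbeat : ∀ O : Finset κ, ∀ t ∈ expand (fun p : Option {X : Finset (Cube pos ℓ) // IsRConnected (fun c c' => cadj c c' ∨ cadj c' c) X} =>
        (Option.elim p (cLoc (fun j x => ldistZ M' pos j (posS x)) ρr Cw) fun r =>
          cX (fun j x => ldistZ M' pos j (posS x)) ρr (cubeOf pos ℓ) cadj Cw r.1 :
          Matrix {x : α // blk x ∈ W} {x : α // blk x ∈ W} ℝ)) (fun p => Option.isSome p) (src blk ℱ W) cv legs obs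
        M 0 O, t.consts = 0 → ∀ X ∈ t.groups,
      max p⁻¹ (max (θv ^ M) θw) * ∏ j ∈ X.lab.filter (fun j => j ∉ bdry), Bl ^ (obs j).length ≤ 1) :
    BIJ88Sect5StatementsPart4.Ineq312 (remSys κ (Cube pos ℓ))
      (fun OX => remAt (prec blk Δ W (corner ℝ W)) (fun p : Option {X : Finset (Cube pos ℓ) // IsRConnected (fun c c' => cadj c c' ∨ cadj c' c) X} =>
          (Option.elim p (cLoc (fun j x => ldistZ M' pos j (posS x)) ρr Cw) fun r =>
          cX (fun j x => ldistZ M' pos j (posS x)) ρr (cubeOf pos ℓ) cadj Cw r.1 :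
            Matrix {x : α // blk x ∈ W} {x : α // blk x ∈ W} ℝ)) (fun p => Option.isSome p) (src blk ℱ W) cv legs obs M
        (fun ψ => ∏ b ∈ Bs, g (p⁻¹ * (ContinuousLinearMap.proj (y b) : ({x : α // blk x ∈ W} → ℝ) →L[ℝ] ℝ) ψ))
        oc vc (fun p => Option.elim p (∅ : Finset (Cube pos ℓ)) fun r => r.1) [] 0 OX.1 OX.2
        / ∫ φ, weight (prec blk Δ W (corner ℝ W)) φ * source (src blk ℱ W) φ)
      (fun OX => KV * ((max 1 (max 1 cg * (max 1 (phi0 legs obs M OX.1 : ℝ)) ^ cg)) ^ phi0 legs obs M OX.1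
            * ∑ N ∈ range (phi0 legs obs M OX.1 + 1), 2 ^ N * (μs ^ N + (1 + vs ^ N * ((2 * N - 1).doubleFactorial : ℝ))))
          * (max 1 (2 * (phi0 legs obs M OX.1 : ℝ) + L * (((3 ^ dd : ℕ) : ℝ) + 1))) ^ phi0 legs obs M OX.1)
      (fun OX => ∏ j ∈ OX.1.filter (fun j => j ∈ bdry), Bl ^ (obs j).length)
      (fun OX => nfreeOf oc OX.2) θ 1 := by
  have hM'r : (0 : ℝ) < M' := by exact_mod_cast hM'
  -- `hblk`: a site of the block of `j` lies in a cube equal or `cadj`-adjacent to the cube of `j`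
  have hblk : ∀ (x : {x : α // blk x ∈ W}) (j : J), ldistZ M' pos j (posS x) ≤ (M' : ℝ) * t →
      cube x ∈ closure cadj {cubeOf pos ℓ j} := by
    intro x j hxj
    have ht : cubeAdj Subtype.val (cubeOf pos ℓ j) (cube x) := by
      intro μ
      rw [hcube x]
      exact touch_cube_of_ldistZ_le pos hM' htℓ hxj μ
    rcases htouch _ _ ht with h | h
    · exact mem_closure.mpr (Or.inl (by rw [← h]; exact Finset.mem_singleton_self _))
    · exact mem_closure.mpr (Or.inr ⟨cubeOf pos ℓ j, Finset.mem_singleton_self _, h⟩)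
  -- `hnear`: sites within `2ρ < ℓM′` have touching cubes
  have hnear : ∀ x₁ x₂ : {x : α // blk x ∈ W}, supDist (posS x₁) (posS x₂) ≤ 2 * ρr →
      cubeAdj Subtype.val (cube x₂) (cube x₁) := by
    intro x₁ x₂ h12 μ
    rw [hcube x₂, hcube x₁]
    have hlt : supDist (posS x₂) (posS x₁) < ((ℓ * M' : ℕ) : ℝ) := by rw [supDist_comm]; linarith
    exact cubeIdx_touch_of_supDist_lt (Nat.mul_pos hℓ hM') hlt μ
  -- `s_c = (ℓM′)^d`
  have hsc : ∀ k : Cube pos ℓ, (univ.filter fun x => cube x = k).card ≤ (ℓ * M') ^ dd := fun k =>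
    (Finset.card_le_card fun x hx => by
      rw [Finset.mem_filter] at hx ⊢
      exact ⟨hx.1, by rw [← hcube x, hx.2]⟩).trans (card_filter_cubeIdx_eq_le posS hposS (Nat.mul_pos hℓ hM') k.1)
  -- the cube adjacency (symmetrized `cadj`) sits inside touching
  have hnbr : ∀ c c' : Cube pos ℓ, (cadj c c' ∨ cadj c' c) →
      c' ∈ univ.filter fun c'' => cubeAdj Subtype.val c c'' := by
    intro c c' h
    rw [Finset.mem_filter]
    rcases h with h | h
    · exact ⟨Finset.mem_univ _, hcadj _ _ h⟩
    · exact ⟨Finset.mem_univ _, touch_symm pos ℓ _ _ (hcadj _ _ h)⟩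
  -- `C_s` on `ℤ^d`
  have hCs0 : 0 ≤ Cs := by
    rw [hCs]
    exact pow_nonneg (div_nonneg zero_le_two (sub_nonneg.mpr (Real.exp_le_one_iff.mpr
      (neg_nonpos.mpr (div_nonneg (div_nonneg hδ.le hM'r.le) (Nat.cast_nonneg _)))))) _
  have hsum : ∀ y' : {x : α // blk x ∈ W}, ∑ x, Real.exp (-(δ / M' * supDist (posS x) (posS y'))) ≤ Cs := fun y' => by
    rw [hCs]
    exact sum_exp_neg_supDist_le hd posS hposS (div_pos hδ hM'r) (posS y')
  refine ineq312_remainder_bdry_split245_decay_walks hPD (cubeAdj pos) (fun j x => ldistZ M' pos j (posS x)) ρr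
    (cubeOf pos ℓ) cadj Cw (fun x j => ldistZ M' pos j (posS x) ≤ (M' : ℝ) * t) cube
    (fun i l => supDist (pos i) (pos l)) (fun i => supDist_self _) (fun i l => supDist_comm _ _)
    (fun i j l => supDist_triangle _ _ _) (fun i l h => supDist_le_one_of_cubeAdj pos h)
    (cubeAdj Subtype.val) (touch_refl pos ℓ) (touch_symm pos ℓ) (card_touch_le pos ℓ)
    (card_closureNbhd_le pos ℓ cadj hcadj) (le_supDist_of_not_touch_cubeOf pos hℓ) hM'r
    (fun i l x => ldistZ_le M' pos i l (posS x)) (fun x i h => h) hρ8 hA hβ0 (card_cubeAdj_le pos hpos) hδ hDβ hmaj hnz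
    (fun x => exists_blocks hM' t pos hpos (posS x)) hMw hs hlarge hc hK₀ hblk (fun x y => supDist (posS x) (posS y))
    hCs0 hsum (fun j x₁ x₂ => supDist_le_ldistZ M' pos j (posS x₁) (posS x₂)) (cubeAdj Subtype.val) hnear
    (fun k => ?_) hsc (fun c c' => cadj c c' ∨ cadj c' c) (fun c c' h => h.symm) (card_touch_univ_le pos ℓ) hnbr hsmall
    hRinf hR1 Bs hy hg hgc hV hp1 hμs hvs hobsm hlegsm hθ0 hθ1 hBl hcV0 hθv hθv1 hθw hθw1 hcV hobs hlegs hvert hleg hL h4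
    hθrek hBl' hθw' bdry hbeat
  -- `D = 3^d`: W6b′'s `near` carries the classical `Decidable` instance (`convert`)
  convert card_touch_univ_le pos ℓ k

/-! ## §2  Kernel non-vacuity of the head on print's split, on `ℤ^d` -/

section Toy

open BIJ88Sect5Statements (CutoffProfile)
open BIJ88VertexIbp311 (vpoly)
open BIJ88WalkIneq312NonVacuity (toy_prec_posDef)

/-- `e^{−1} ≤ ½` (bookkeeping for the toy's largeness numbers). [folklore] -/
private theorem exp_neg_one_le_half : Real.exp (-1) ≤ 1 / 2 := by
  have he2 : (2 : ℝ) ≤ Real.exp 1 := by linarith [Real.add_one_le_exp (1 : ℝ)]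
  rw [Real.exp_neg, inv_le_comm₀ (Real.exp_pos _) (by norm_num)]
  norm_num
  exact he2

/-- `e^{−n} ≤ 2^{−n}` (bookkeeping for the toy's largeness numbers). [folklore] -/
private theorem exp_neg_natCast_le (n : ℕ) : Real.exp (-(n : ℝ)) ≤ (1 / 2) ^ n := by
  rw [show (-(n : ℝ)) = n * (-1 : ℝ) by ring, Real.exp_nat_mul]
  exact pow_le_pow_left₀ (Real.exp_pos _).le exp_neg_one_le_half n

/-- **KERNEL NON-VACUITY OF `ineq312_remainder_bdry_split245_Zd`**: every binder of the `ℤ^d` head is inhabited and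
every hypothesis discharged by the kernel on the one-site toy of `BIJ88WalkIneq312NonVacuity` placed in `ℤ^1` (one
label at `0`, one site at `0`, `ℓ = 24` labels per cube, `M′ = 1`, `t = 0`, `ρ = 4`; zero walk kernels, `A = 1`,
`β = 0`, `δ = 288`, `M_w = 1`, `r(e_k) = 24`, so `c = δ/(32·9·M_w) = 1`, `c·r(e_k) = 24`, *"r(e_k) large"* reads
`1 ≤ e^{24}`, `(3+1)²e·e^{−12} ≤ ½`, `e^{−6}·24·R₁K_w = 48e^{−6} ≤ θ_w = 1`, `K₀C_sR₁K_w = 4/(1 − e^{−288}) ≤ B_ℓ = 8`;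
one observable with the leg `1`, no vertex, site cutoff `χ₁(ψ(site)/1)` for ANY `χ₁ : CutoffProfile`) — the
hypotheses of the `ℤ^d` head (largeness numbers and the three dictionary inequalities included) are jointly
satisfiable.  Nothing about print beyond consistency. [cite: BalabanImbrieJaffe1988, §5.14 p.312 (estimate preceding (5.14.5))] -/
example (χp : CutoffProfile) {cg : ℝ}
    (hgc : ∀ (n : ℕ) (x : ℝ), |iteratedDeriv n χp.χ₁ x| ≤ cg ^ n * (n : ℝ) ^ (cg * n)) :=
  have hsrc : src (fun _ : Unit => ()) (0 : Unit → ℝ) ({()} : Finset Unit) = 0 := by funext x; simp [src]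
  have hV : ∀ φ : {x : Unit // (fun _ : Unit => ()) x ∈ ({()} : Finset Unit)} → ℝ,
      |vexp (fun _ : Fin 0 => (0 : ℝ)) (fun _ : Fin 0 => []) φ| ≤ 1 := fun φ => by simp [vexp, vpoly]
  have hcard : ((Finset.univ : Finset {x : Unit // (fun _ : Unit => ()) x ∈ ({()} : Finset Unit)}).card : ℝ) ≤ 1 := by
    exact_mod_cast Finset.card_le_one.2 fun _ _ _ _ => Subsingleton.elim _ _
  -- one label at the origin of `ℤ^1`: one cube
  have hcub : ∀ c c' : Cube (fun (_ : Unit) (_ : Fin 1) => (0 : ℤ)) 24, c = c' := fun c c' => by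
    obtain ⟨k, hk⟩ := c
    obtain ⟨k', hk'⟩ := c'
    obtain ⟨a, -, ha⟩ := Finset.mem_image.1 hk
    obtain ⟨a', -, ha'⟩ := Finset.mem_image.1 hk'
    exact Subtype.ext (ha.symm.trans ha')
  have hE : Real.exp (-(6 : ℝ)) ≤ 1 / 64 := by
    have := exp_neg_natCast_le 6
    norm_num at this
    exact this
  have hE' : Real.exp (-(288 : ℝ)) ≤ 1 / 2 :=
    (Real.exp_le_exp.mpr (by norm_num)).trans exp_neg_one_le_half
  ineq312_remainder_bdry_split245_Zd (ι := Fin 0) (κ := Unit) (J := Unit) toy_prec_posDef Nat.one_pos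
    (fun (_ : Unit) (_ : Fin 1) => (0 : ℤ)) (fun _ _ _ => Subsingleton.elim _ _)
    (fun (_ : {x : Unit // (fun _ : Unit => ()) x ∈ ({()} : Finset Unit)}) (_ : Fin 1) => (0 : ℤ)) (fun _ _ _ => Subsingleton.elim _ _)
    (ℓ := 24) (M' := 1) (t := 0) (by norm_num) Nat.one_pos (by norm_num) 4 (by norm_num) (by norm_num)
    (fun _ _ => False) (fun _ _ h => h.elim) (fun c c' _ => Or.inl (hcub c c'))
    (fun _ => cubeOf (fun (_ : Unit) (_ : Fin 1) => (0 : ℤ)) 24 ()) (fun _ => rfl)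
    (fun _ _ _ => (0 : ℝ)) (A := 1) (βw := 0) (δ := 288) zero_le_one le_rfl (by norm_num)
    (by rw [mul_zero]; exact (Real.exp_pos _).le)
    (fun γ _ _ => by rw [abs_zero, one_mul]; exact pow_nonneg le_rfl _) (fun _ _ _ h => (h rfl).elim)
    (Mw := 1) (rek := 24) one_pos (by norm_num)
    (by norm_num)
    (c := 1) (by norm_num) (K₀ := 1) (by norm_num) rfl
    (by
      have h : Real.exp 1 * Real.exp (-(1 * 24 / 2)) = Real.exp (-((11 : ℕ) : ℝ)) := by
        rw [← Real.exp_add]; norm_num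
      rw [h]
      have h11 := exp_neg_natCast_le 11
      have h0 := (Real.exp_pos (-((11 : ℕ) : ℝ))).le
      norm_num at h11 h0 ⊢
      nlinarith)
    (Rinf := 1) (R1 := 1) zero_le_one zero_le_one
    (cv := fun _ : Fin 0 => (0 : ℝ)) (legs := fun _ : Fin 0 => [])
    (obs := fun _ : Unit => [fun _ => (1 : ℝ)]) (M := 1) (oc := fun _ : Unit => ∅)
    (vc := fun _ : Fin 0 => ∅) (cV := fun _ : Fin 0 => (0 : ℝ)) (Bl := 8) (θ := 1) (θv := 1) (θw := 1)
    (legCube := fun _ _ => cubeOf (fun (_ : Unit) (_ : Fin 1) => (0 : ℤ)) 24 ()) (L := 0)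
    (Finset.univ : Finset Unit) (y := fun _ : Unit => ⟨(), Finset.mem_singleton_self ()⟩)
    (fun _ _ _ _ _ => Subsingleton.elim _ _) χp.smooth hgc (KV := 1) (p := 1) (μs := 0)
    (vs := max ((fun _ => (1 : ℝ)) ⬝ᵥ ((prec (fun _ : Unit => ()) (1 : Matrix Unit Unit ℝ) ({()} : Finset Unit)
      (corner ℝ ({()} : Finset Unit)))⁻¹ *ᵥ fun _ => (1 : ℝ))) 0)
    hV le_rfl le_rfl (le_max_right _ _)
    (fun _ w hw => by
      rw [List.mem_singleton] at hw; subst hw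
      rw [hsrc, Matrix.mulVec_zero, dotProduct_zero, abs_zero]
      exact ⟨le_rfl, le_max_left _ _⟩)
    (fun m => m.elim0) one_pos le_rfl (by norm_num) (fun m => m.elim0) one_pos le_rfl one_pos le_rfl (fun m => m.elim0)
    (fun _ w hw => by
      rw [List.mem_singleton] at hw; subst hw
      refine ⟨⟨cubeOf (fun (_ : Unit) (_ : Fin 1) => (0 : ℤ)) 24 (), fun _ _ => rfl⟩,
        (pi_norm_le_iff_of_nonneg zero_le_one).2 fun _ => by simp, ?_⟩
      calc ∑ x, |(fun _ : {x : Unit // (fun _ : Unit => ()) x ∈ ({()} : Finset Unit)} => (1 : ℝ)) x|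
          = ((Finset.univ : Finset {x : Unit // (fun _ : Unit => ()) x ∈ ({()} : Finset Unit)}).card : ℝ) := by simp
        _ ≤ 1 := hcard)
    (fun m => m.elim0) (fun m => m.elim0) (fun m => m.elim0)
    (fun _ => by simp) (by norm_num) (Real.exp_le_one_iff.mpr (by norm_num))
    (by
      rw [hsrc, norm_zero]
      have h0 : 0 < 1 - Real.exp (-(288 : ℝ)) := by linarith
      have hq : 2 / (1 - Real.exp (-(288 : ℝ))) ≤ 4 := by rw [div_le_iff₀ h0]; linarith
      have hq0 : 0 ≤ 2 / (1 - Real.exp (-(288 : ℝ))) := div_nonneg zero_le_two h0.le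
      norm_num
      nlinarith)
    (by
      rw [hsrc, norm_zero]
      have h : Real.exp (-(1 * 24 / 4 : ℝ)) = Real.exp (-(6 : ℝ)) := by norm_num
      rw [h]
      norm_num
      linarith)
    ({()} : Finset Unit) (fun O t _ _ X _ => by simp)

end Toy

end Literature.MathematicalPhysics.QuantumFieldTheory.BalabanImbrieJaffe1984to88.BIJ88WalkIneq312Split245Zd

end
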